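import Summits.KontsevichZagierPeriods.KontsevichZagierPeriods.Theorems.RootDecompWalshStrataSplit4Band

/-!
# The split specimen `xy + zw > 1`, part 2/3: the hyperbolic chart `(u₀, u₁, u₂) ↦ (u₁, u₂, u₀u₁)`

Route `RootDecompWalshStrata` (cell decomp-kz, lens 4, gen 11), support toward `QuadricSignKernel`
(item stmt-KontsevichZagierPeriods-25393), slice `d = 4`.  After part 1 the split cell is
`[B₁, q(u₂ + u₀u₁ − 1)/u₂]`, `B₁ = (0,1)³ ∩ {u₂ + u₀u₁ > 1}`.  The POLYNOMIAL chart
`φ(u) = (u₁, u₂, u₀u₁)` (Jacobian `u₁`, injective on `{u₁ > 0}`, inverse `(v₂/v₀, v₀, v₁)`) maps `B₁`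
onto the 3-cell `T₂ = {v | v₀, v₁ ∈ (0,1), 0 < v₂ < v₀, v₁ + v₂ > 1}` (a Walsh cell cut by the plane
`v₂ < v₀`) and linearises the quadric: rule (2) gives
`[B₁, q(u₂ + u₀u₁ − 1)/u₂] − [T₂, q(v₁ + v₂ − 1)/(v₀v₁)] ∈ KZ.relations`, the target weight again
bounded by `|q|` (`v₁ + v₂ − 1 < v₀ + v₁ − 1 ≤ v₀v₁`).  0 sorry.  [KontsevichZagier2001 §1.2 rule (2)]
-/

noncomputable section

open Literature.NumberTheory.Transcendental
open MeasureTheory Set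
open MvPolynomial (aeval X C)
open Literature.ModelTheory.ExponentialFields (IsSemialgebraic isSemialgebraic_setOf_eval_pos
  isSemialgebraic_setOf_eval_lt continuous_aeval_real)
open Summit.KontsevichZagierPeriods.RootDecompWalshStrata.WalshSpanProof (isSemialgebraic_cubeSet
  isBounded_cubeSet cellRep cellRep_domain cellRep_integrand)
open Summit.KontsevichZagierPeriods.RootDecompWalshStrata.ConeSpecimen (cubeCell_subset_Icc)

namespace Summit.KontsevichZagierPeriods.RootDecompWalshStrata.Split4

/-! #### The target 3-cell `T₂` and the target representation -/

/-- The linearised quadric `v₁ + v₂ − 1`. -/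
def t2Poly : MvPolynomial (Fin 3) ℚ := X 1 + X 2 - 1

/-- Evaluation of the linearised quadric. [definition] -/
@[simp] theorem aeval_t2Poly (v : Fin 3 → ℝ) : aeval v t2Poly = v 1 + v 2 - 1 := by simp [t2Poly]

/-- The target 3-cell `T₂ = (0,1)³ ∩ {v₁ + v₂ > 1} ∩ {v₂ < v₀}`. -/
def t2Set : Set (Fin 3 → ℝ) :=
  {v | (∀ j, 0 < v j ∧ v j < 1) ∧ 0 < aeval v t2Poly} ∩ {v | 0 < aeval v (X 0 - X 2 : MvPolynomial (Fin 3) ℚ)}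

/-- `T₂` is `ℚ`-semialgebraic. [BCR1998 §2.1] -/
theorem isSemialgebraic_t2Set : IsSemialgebraic ℚ t2Set :=
  (cellRep t2Poly 0).isSemialgebraic_domain.inter (isSemialgebraic_setOf_eval_pos _)

/-- `T₂ ⊆ [0,1]³`. [folklore] -/
theorem t2Set_subset_Icc : t2Set ⊆ Icc 0 1 := fun _ hv => cubeCell_subset_Icc t2Poly hv.1

/-- Membership in `T₂`, in coordinates. [definition] -/
theorem mem_t2Set {v : Fin 3 → ℝ} :
    v ∈ t2Set ↔ ((0 < v 0 ∧ v 0 < 1) ∧ (0 < v 1 ∧ v 1 < 1) ∧ (0 < v 2 ∧ v 2 < 1)) ∧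
      0 < v 1 + v 2 - 1 ∧ v 2 < v 0 := by
  simp only [t2Set, mem_inter_iff, mem_setOf_eq, aeval_t2Poly, map_sub, MvPolynomial.aeval_X, sub_pos]
  exact ⟨fun ⟨⟨hu, hc⟩, hlt⟩ => ⟨⟨hu 0, hu 1, hu 2⟩, hc, hlt⟩, fun ⟨⟨h0, h1, h2⟩, hc, hlt⟩ =>
    ⟨⟨fun j => by fin_cases j <;> assumption, hc⟩, hlt⟩⟩

/-- On `T₂` the target weight is between `0` and `q`: `0 < (v₁ + v₂ − 1)/(v₀v₁) < 1`. [folklore] -/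
theorem ratio₂_mem_Ioo {v : Fin 3 → ℝ} (h0 : 0 < v 0 ∧ v 0 < 1) (h1 : 0 < v 1 ∧ v 1 < 1)
    (hc : 0 < v 1 + v 2 - 1) (hlt : v 2 ≤ v 0) :
    0 < (v 1 + v 2 - 1) / (v 0 * v 1) ∧ (v 1 + v 2 - 1) / (v 0 * v 1) < 1 := by
  have hp : 0 < v 0 * v 1 := mul_pos h0.1 h1.1
  refine ⟨div_pos hc hp, (div_lt_one hp).2 ?_⟩
  nlinarith [mul_nonneg (sub_nonneg.2 h0.2.le) (sub_nonneg.2 h1.2.le)]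

/-- `[T₂, q(v₁ + v₂ − 1)/(v₀v₁)]`: the target representation of the chart (a bounded rational weight).
[KontsevichZagier2001 §1.1] -/
def t2Rep (q : ℚ) : KZ.IntegralRep 3 where
  domain := t2Set
  integrand v := (q : ℝ) * (v 1 + v 2 - 1) / (v 0 * v 1)
  isSemialgebraic_domain := isSemialgebraic_t2Set
  isSemialgebraicFunOn_integrand :=
    (isSemialgebraicFunOn_aeval_div_aeval isSemialgebraic_t2Set (C q * (X 1 + X 2 - 1)) (X 0 * X 1)
      fun v hv => by
        have h := mem_t2Set.1 hv
        simpa using (mul_pos h.1.1.1 h.1.2.1.1).ne').congr fun v _ => by simp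
  integrableOn := by
    refine integrableOn_of_bdd t2Set_subset_Icc isSemialgebraic_t2Set.measurableSet_holds
      (by fun_prop) |(q : ℝ)| fun v hv => ?_
    have h := mem_t2Set.1 hv
    have hr := ratio₂_mem_Ioo h.1.1 h.1.2.1 h.2.1 h.2.2.le
    rw [mul_div_assoc, abs_mul, abs_of_pos hr.1]
    exact mul_le_of_le_one_right (abs_nonneg _) hr.2.le

/-- The domain of the target representation. [definition] -/
@[simp] theorem t2Rep_domain (q : ℚ) : (t2Rep q).domain = t2Set := rfl

/-- The integrand of the target representation. [definition] -/
@[simp] theorem t2Rep_integrand (q : ℚ) (v : Fin 3 → ℝ) :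
    (t2Rep q).integrand v = (q : ℝ) * (v 1 + v 2 - 1) / (v 0 * v 1) := rfl

/-! #### The hyperbolic chart `φ(u) = (u₁, u₂, u₀u₁)` -/

/-- The chart as a polynomial map. -/
def phiPoly : Fin 3 → MvPolynomial (Fin 3) ℚ := ![X 1, X 2, X 0 * X 1]

/-- `φ(u) = (u₁, u₂, u₀u₁)`. -/
def phi : (Fin 3 → ℝ) → (Fin 3 → ℝ) := fun u j => aeval u (phiPoly j)

/-- `φ(u)₀ = u₁`. [definition] -/
@[simp] theorem phi_zero (u : Fin 3 → ℝ) : phi u 0 = u 1 := by simp [phi, phiPoly]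

/-- `φ(u)₁ = u₂`. [definition] -/
@[simp] theorem phi_one (u : Fin 3 → ℝ) : phi u 1 = u 2 := by simp [phi, phiPoly]

/-- `φ(u)₂ = u₀u₁`. [definition] -/
@[simp] theorem phi_two (u : Fin 3 → ℝ) : phi u 2 = u 0 * u 1 := by simp [phi, phiPoly]

/-- The Jacobian matrix of `φ`. -/
def phiMat (u : Fin 3 → ℝ) : Matrix (Fin 3) (Fin 3) ℝ := !![0, 1, 0; 0, 0, 1; u 1, u 0, 0]

/-- The derivative of `φ` as a continuous linear map. -/
def phi' (u : Fin 3 → ℝ) : (Fin 3 → ℝ) →L[ℝ] (Fin 3 → ℝ) :=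
  LinearMap.toContinuousLinearMap (Matrix.toLin' (phiMat u))

/-- `φ'(u)` acts by the Jacobian matrix. [calculus] -/
theorem phi'_apply (u v : Fin 3 → ℝ) (a : Fin 3) : phi' u v a = ∑ b, phiMat u a b * v b := by
  change Matrix.toLin' (phiMat u) v a = _
  rw [Matrix.toLin'_apply]
  rfl

/-- `det φ'(u) = u₁`. [calculus] -/
theorem phi'_det (u : Fin 3 → ℝ) : (phi' u).det = u 1 := by
  change LinearMap.det (Matrix.toLin' (phiMat u)) = _
  rw [LinearMap.det_toLin', phiMat, Matrix.det_fin_three]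
  simp

/-- `φ` is differentiable with derivative `φ'`. [calculus] -/
theorem hasFDerivAt_phi (u : Fin 3 → ℝ) : HasFDerivAt phi (phi' u) u := by
  have h0 : HasFDerivAt (fun z : Fin 3 → ℝ => phi z 0)
      ((ContinuousLinearMap.proj 0).comp (phi' u)) u := by
    have hf : (fun z : Fin 3 → ℝ => phi z 0) = fun z => z 1 := funext phi_zero
    rw [hf]
    refine (hasFDerivAt_apply 1 u).congr_fderiv (ContinuousLinearMap.ext fun v => ?_)
    simp [phi'_apply, phiMat, Fin.sum_univ_three]
  have h1 : HasFDerivAt (fun z : Fin 3 → ℝ => phi z 1)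
      ((ContinuousLinearMap.proj 1).comp (phi' u)) u := by
    have hf : (fun z : Fin 3 → ℝ => phi z 1) = fun z => z 2 := funext phi_one
    rw [hf]
    refine (hasFDerivAt_apply 2 u).congr_fderiv (ContinuousLinearMap.ext fun v => ?_)
    simp [phi'_apply, phiMat, Fin.sum_univ_three]
  have h2 : HasFDerivAt (fun z : Fin 3 → ℝ => phi z 2)
      ((ContinuousLinearMap.proj 2).comp (phi' u)) u := by
    have hf : (fun z : Fin 3 → ℝ => phi z 2) = fun z => z 0 * z 1 := funext phi_two
    rw [hf]
    refine ((hasFDerivAt_apply 0 u).mul (hasFDerivAt_apply 1 u)).congr_fderiv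
      (ContinuousLinearMap.ext fun v => ?_)
    simp [phi'_apply, phiMat, Fin.sum_univ_three]
    ring
  refine hasFDerivAt_pi'' fun a => ?_
  fin_cases a
  · exact h0
  · exact h1
  · exact h2

/-- `φ` is injective where `u₁ > 0`. [calculus] -/
theorem injOn_phi : InjOn phi {u | 0 < u 1} := by
  intro x hx y _ hxy
  have e0 : x 1 = y 1 := by simpa using congrFun hxy 0
  have e1 : x 2 = y 2 := by simpa using congrFun hxy 1
  have e2 : x 0 * x 1 = y 0 * y 1 := by simpa using congrFun hxy 2
  have h0 : x 0 = y 0 := by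
    have h : x 0 * x 1 = y 0 * x 1 := by rw [e2, e0]
    exact mul_right_cancel₀ (ne_of_gt hx) h
  funext a
  fin_cases a
  · exact h0
  · exact e0
  · exact e1

/-- `φ` maps `B₁` onto `T₂` (inverse `u = (v₂/v₀, v₀, v₁)`). [calculus] -/
theorem image_phi : phi '' b1Set = t2Set := by
  ext v
  rw [mem_image, mem_t2Set]
  constructor
  · rintro ⟨u, hu, rfl⟩
    rw [mem_b1Set] at hu
    obtain ⟨⟨h0, h1, h2⟩, hc⟩ := hu
    have hp : 0 < u 0 * u 1 := mul_pos h0.1 h1.1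
    have hlt : u 0 * u 1 < u 1 := by nlinarith
    simp only [phi_zero, phi_one, phi_two]
    exact ⟨⟨h1, h2, hp, hlt.trans h1.2⟩, by linarith, hlt⟩
  · rintro ⟨⟨h0, h1, h2⟩, hc, hlt⟩
    have hne : v 0 ≠ 0 := h0.1.ne'
    refine ⟨![v 2 / v 0, v 0, v 1], ?_, ?_⟩
    · rw [mem_b1Set]
      simp only [Matrix.cons_val_zero, Matrix.cons_val_one, Matrix.cons_val]
      refine ⟨⟨⟨div_pos h2.1 h0.1, (div_lt_one h0.1).2 hlt⟩, h0, h1⟩, ?_⟩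
      have e : v 2 / v 0 * v 0 = v 2 := by field_simp
      rw [e]
      linarith
    · funext a
      fin_cases a
      · simp
      · simp only [Fin.reduceFinMk, phi_one, Matrix.cons_val]
      · simp only [Fin.reduceFinMk, phi_two, Matrix.cons_val_zero, Matrix.cons_val_one]
        field_simp

/-- **Move (2), hyperbolic chart:** `[B₁, q(u₂ + u₀u₁ − 1)/u₂] − [T₂, q(v₁ + v₂ − 1)/(v₀v₁)] ∈
KZ.relations` (`|det φ'| = u₁`). [KontsevichZagier2001 §1.2 rule (2)] -/
theorem of_b1WRep_sub_of_t2Rep_mem_relations (q : ℚ) :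
    KZ.of (b1WRep q) - KZ.of (t2Rep q) ∈ KZ.relations := by
  refine KZ.changeOfVariablesRel_subset_relations
    ⟨3, b1WRep q, t2Rep q, phi, phi', ?_,
      fun u _ => (hasFDerivAt_phi u).hasFDerivWithinAt,
      injOn_phi.mono fun u hu => (mem_b1Set.1 hu).1.2.1.1, ?_, fun u hu => ?_, rfl⟩
  · exact isSemialgebraicMapOn_aeval (b1WRep q).isSemialgebraic_domain phiPoly
  · rw [t2Rep_domain, b1WRep_domain, image_phi]
  · have h := (mem_b1Set.1 hu).1
    have h1 : 0 < u 1 := h.2.1.1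
    have h2 : u 2 ≠ 0 := h.2.2.1.ne'
    rw [b1WRep_integrand, t2Rep_integrand, phi'_det, abs_of_pos h1, phi_zero, phi_one, phi_two]
    field_simp

end Summit.KontsevichZagierPeriods.RootDecompWalshStrata.Split4

end
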